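import Mathlib

/-!
# No conjugate is a proper rational convex combination of two other conjugates (Lemma H)

The "house" rigidity lemma used on the Roy-type additive small-value node
(`SoloInformedRoyAdditiveDirichlet`, `SoloInformedAdditiveCoincidenceRigidity`): if
`x₁ ≠ x₂` and `y` are conjugate algebraic numbers (same minimal polynomial over `ℚ`) inside a
normal extension `E/ℚ` embedded in `ℂ` by `φ`, then `φ y ≠ (1 - w) · φ x₁ + w · φ x₂` for every
rational `0 < w < 1`.  In particular an irreducible polynomial over `ℚ` never has three roots
`a, b, c ∈ ℂ` with `b = (1 - w) a + w c`, `a ≠ c`, `w ∈ ℚ ∩ (0, 1)` — e.g. no three distinct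
roots in arithmetic progression, and no three roots of the shape `γ + s • μ` with distinct
integers `s`.

Proof (folklore maximum-modulus / strict-convexity argument; theme: `ℚ`-linear relations
between conjugate algebraic numbers — no novelty is claimed).  Among the finitely many
conjugates of `y` in `E` choose `z₀` maximising `‖φ z₀‖`; by normality some `ℚ`-automorphism
`f` of `E` maps `y` to `z₀`, and applying `f` then `φ` to the (pulled back) relation gives
`φ z₀ = (1 - w) v₁ + w v₂` with `‖v₁‖, ‖v₂‖ ≤ ‖φ z₀‖`, `vᵢ = φ (f xᵢ)`.  The elementary
identity `(1 - w)‖v₁‖² + w‖v₂‖² = ‖(1 - w) v₁ + w v₂‖² + (1 - w) w ‖v₁ - v₂‖²` forces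
`v₁ = v₂`, hence `x₁ = x₂`.
-/

namespace Summit.Schanuel.Schanuel.Theorems

/-- Strict convexity of the Euclidean norm on `ℂ`, in the form needed here: if
`‖v₁‖, ‖v₂‖ ≤ M ≤ ‖s v₁ + t v₂‖` with real `s, t > 0`, `s + t = 1`, then `v₁ = v₂`. -/
theorem soloCC_eq_of_convex_norm_ge {v₁ v₂ : ℂ} {M s t : ℝ} (hs : 0 < s) (ht : 0 < t)
    (hst : s + t = 1) (h₁ : ‖v₁‖ ≤ M) (h₂ : ‖v₂‖ ≤ M)
    (hM : M ≤ ‖(s : ℂ) * v₁ + (t : ℂ) * v₂‖) : v₁ = v₂ := by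
  have hM0 : 0 ≤ M := le_trans (norm_nonneg _) h₁
  have n1 : ‖v₁‖ ^ 2 = v₁.re ^ 2 + v₁.im ^ 2 := by
    rw [Complex.sq_norm, Complex.normSq_apply]; ring
  have n2 : ‖v₂‖ ^ 2 = v₂.re ^ 2 + v₂.im ^ 2 := by
    rw [Complex.sq_norm, Complex.normSq_apply]; ring
  have nc : ‖(s : ℂ) * v₁ + (t : ℂ) * v₂‖ ^ 2
      = (s * v₁.re + t * v₂.re) ^ 2 + (s * v₁.im + t * v₂.im) ^ 2 := by
    rw [Complex.sq_norm, Complex.normSq_apply]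
    simp only [Complex.add_re, Complex.add_im, Complex.mul_re, Complex.mul_im,
      Complex.ofReal_re, Complex.ofReal_im]
    ring
  have b1 : ‖v₁‖ ^ 2 ≤ M ^ 2 := pow_le_pow_left₀ (norm_nonneg _) h₁ 2
  have b2 : ‖v₂‖ ^ 2 ≤ M ^ 2 := pow_le_pow_left₀ (norm_nonneg _) h₂ 2
  have bc : M ^ 2 ≤ ‖(s : ℂ) * v₁ + (t : ℂ) * v₂‖ ^ 2 := pow_le_pow_left₀ hM0 hM 2
  have hs' : s = 1 - t := by linarith
  subst hs'
  -- the variance identity, written in coordinates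
  have iden : (1 - t) * (v₁.re ^ 2 + v₁.im ^ 2) + t * (v₂.re ^ 2 + v₂.im ^ 2)
      - (((1 - t) * v₁.re + t * v₂.re) ^ 2 + ((1 - t) * v₁.im + t * v₂.im) ^ 2)
      = (1 - t) * t * ((v₁.re - v₂.re) ^ 2 + (v₁.im - v₂.im) ^ 2) := by ring
  have key : (1 - t) * t * ((v₁.re - v₂.re) ^ 2 + (v₁.im - v₂.im) ^ 2) ≤ 0 := by
    have e1 : (1 - t) * ‖v₁‖ ^ 2 ≤ (1 - t) * M ^ 2 := mul_le_mul_of_nonneg_left b1 hs.le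
    have e2 : t * ‖v₂‖ ^ 2 ≤ t * M ^ 2 := mul_le_mul_of_nonneg_left b2 ht.le
    rw [← iden, ← n1, ← n2, ← nc]
    nlinarith [e1, e2, bc]
  have hpos : 0 < (1 - t) * t := mul_pos hs ht
  have hsq : (v₁.re - v₂.re) ^ 2 + (v₁.im - v₂.im) ^ 2 ≤ 0 := by
    by_contra hcon
    exact absurd key (not_le.mpr (mul_pos hpos (lt_of_not_ge hcon)))
  have hre : v₁.re = v₂.re := by nlinarith [sq_nonneg (v₁.re - v₂.re), sq_nonneg (v₁.im - v₂.im)]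
  have him : v₁.im = v₂.im := by nlinarith [sq_nonneg (v₁.re - v₂.re), sq_nonneg (v₁.im - v₂.im)]
  exact Complex.ext hre him

/-- **Lemma H (no conjugate is a proper rational convex combination of two distinct conjugates).**
Let `E/ℚ` be a normal field extension with a ring embedding `φ : E →+* ℂ`, and let
`y, x₁, x₂ ∈ E` have the same minimal polynomial over `ℚ`, with `x₁ ≠ x₂`.  Then for every
rational `0 < w < 1`, `φ y ≠ (1 - w) · φ x₁ + w · φ x₂`. -/
theorem soloCC_conj_ne_ratConvexComb {E : Type*} [Field E] [Algebra ℚ E] [Normal ℚ E]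
    (φ : E →+* ℂ) {y x₁ x₂ : E} (h₁ : minpoly ℚ x₁ = minpoly ℚ y)
    (h₂ : minpoly ℚ x₂ = minpoly ℚ y) (hne : x₁ ≠ x₂) {w : ℚ} (hw0 : 0 < w) (hw1 : w < 1) :
    φ y ≠ ((1 - w : ℚ) : ℂ) * φ x₁ + (w : ℂ) * φ x₂ := by
  classical
  intro hEq
  have hint : ∀ z : E, IsIntegral ℚ z := fun z => Normal.isIntegral ‹Normal ℚ E› z
  set p := minpoly ℚ y with hp
  have hpirr : Irreducible p := minpoly.irreducible (hint y)
  have hpmonic : p.Monic := minpoly.monic (hint y)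
  have hpmap : p.map (algebraMap ℚ E) ≠ 0 := (hpmonic.map (algebraMap ℚ E)).ne_zero
  -- the (finite) set of conjugates of `y` inside `E`
  let S : Finset E := (p.rootSet E).toFinset
  have memS : ∀ z : E, minpoly ℚ z = p → z ∈ S := by
    intro z hz
    simp only [S, Set.mem_toFinset]
    rw [Polynomial.mem_rootSet']
    refine ⟨hpmap, ?_⟩
    rw [← hz]
    exact minpoly.aeval ℚ z
  have minS : ∀ z ∈ S, minpoly ℚ z = p := by
    intro z hz
    simp only [S, Set.mem_toFinset] at hz
    rw [Polynomial.mem_rootSet'] at hz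
    exact (minpoly.eq_of_irreducible_of_monic hpirr hz.2 hpmonic).symm
  -- a conjugate of maximal modulus under `φ`
  obtain ⟨z₀, hz₀S, hmax⟩ := Finset.exists_max_image S (fun z => ‖φ z‖) ⟨y, memS y rfl⟩
  -- a `ℚ`-automorphism of `E` taking `y` to `z₀` (normality)
  obtain ⟨f, hf⟩ : ∃ f : E ≃ₐ[ℚ] E, f y = z₀ := by
    have horb := (Normal.minpoly_eq_iff_mem_orbit (F := ℚ) (E := E)).mp (minS z₀ hz₀S)
    obtain ⟨f, hf⟩ := MulAction.mem_orbit_iff.mp horb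
    exact ⟨f, hf⟩
  -- transport the relation: pull back along `φ`, apply `f`, push forward along `φ`
  have hφq : ∀ q : ℚ, φ (algebraMap ℚ E q) = (q : ℂ) := fun q =>
    eq_ratCast (φ.comp (algebraMap ℚ E)) q
  have key : y = algebraMap ℚ E (1 - w) * x₁ + algebraMap ℚ E w * x₂ := by
    apply φ.injective
    rw [map_add, map_mul, map_mul, hφq, hφq]
    exact hEq
  have key2 : φ z₀ = ((1 - w : ℚ) : ℂ) * φ (f x₁) + (w : ℂ) * φ (f x₂) := by
    rw [← hf, key]
    simp only [map_add, map_mul, AlgEquiv.commutes, hφq]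
  -- norms of conjugates are bounded by the maximal one
  have hb1 : ‖φ (f x₁)‖ ≤ ‖φ z₀‖ := hmax _ (memS _ (by rw [minpoly.algEquiv_eq, h₁]))
  have hb2 : ‖φ (f x₂)‖ ≤ ‖φ z₀‖ := hmax _ (memS _ (by rw [minpoly.algEquiv_eq, h₂]))
  -- strict convexity
  have hs : (0 : ℝ) < ((1 - w : ℚ) : ℝ) := by exact_mod_cast sub_pos.mpr hw1
  have ht : (0 : ℝ) < ((w : ℚ) : ℝ) := by exact_mod_cast hw0
  have hst : ((1 - w : ℚ) : ℝ) + ((w : ℚ) : ℝ) = 1 := by push_cast; ring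
  have hM : ‖φ z₀‖ ≤ ‖((((1 - w : ℚ) : ℝ)) : ℂ) * φ (f x₁) + ((((w : ℚ) : ℝ)) : ℂ) * φ (f x₂)‖ :=
    le_of_eq (by rw [Complex.ofReal_ratCast, Complex.ofReal_ratCast, ← key2])
  have heq : φ (f x₁) = φ (f x₂) := soloCC_eq_of_convex_norm_ge hs ht hst hb1 hb2 hM
  exact hne (f.injective (φ.injective heq))

open Polynomial in
/-- **Corollary (three roots of an irreducible rational polynomial are never in rational convex
position).**  If `p ∈ ℚ[X]` is irreducible and `a, b, c ∈ ℂ` are roots of `p` with `a ≠ c`,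
then `b ≠ (1 - w) a + w c` for every rational `0 < w < 1`. -/
theorem soloCC_roots_ne_ratConvexComb (p : ℚ[X]) (hp : Irreducible p) {a b c : ℂ}
    (ha : aeval a p = 0) (hb : aeval b p = 0) (hc : aeval c p = 0) (hac : a ≠ c)
    {w : ℚ} (hw0 : 0 < w) (hw1 : w < 1) :
    b ≠ ((1 - w : ℚ) : ℂ) * a + (w : ℂ) * c := by
  -- work inside the algebraic closure of `ℚ` in `ℂ`, a normal extension of `ℚ`
  haveI hAC : IsAlgClosure ℚ (algebraicClosure ℚ ℂ) := algebraicClosure.isAlgClosure ℚ ℂ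
  haveI hN : Normal ℚ (algebraicClosure ℚ ℂ) := IsAlgClosure.normal ℚ _
  have hint : ∀ {x : ℂ}, aeval x p = 0 → IsIntegral ℚ x := fun hx =>
    (isAlgebraic_iff_isIntegral (K := ℚ)).mp ⟨p, hp.ne_zero, hx⟩
  have memK : ∀ {x : ℂ}, aeval x p = 0 → x ∈ algebraicClosure ℚ ℂ := fun hx =>
    (mem_algebraicClosure_iff' (F := ℚ) (E := ℂ)).mpr (hint hx)
  -- minimal polynomials of roots of the irreducible `p` all agree
  have hmin : ∀ {x : ℂ}, aeval x p = 0 → minpoly ℚ x = p * C p.leadingCoeff⁻¹ := fun hx =>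
    (minpoly.eq_of_irreducible hp hx).symm
  have hminK : ∀ x : algebraicClosure ℚ ℂ, minpoly ℚ x = minpoly ℚ (x : ℂ) := fun x =>
    (minpoly.algHom_eq (algebraicClosure ℚ ℂ).val (algebraicClosure ℚ ℂ).val.injective x).symm
  have h₁ : minpoly ℚ (⟨a, memK ha⟩ : algebraicClosure ℚ ℂ)
      = minpoly ℚ (⟨b, memK hb⟩ : algebraicClosure ℚ ℂ) := by
    rw [hminK, hminK]
    show minpoly ℚ a = minpoly ℚ b
    rw [hmin ha, hmin hb]
  have h₂ : minpoly ℚ (⟨c, memK hc⟩ : algebraicClosure ℚ ℂ)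
      = minpoly ℚ (⟨b, memK hb⟩ : algebraicClosure ℚ ℂ) := by
    rw [hminK, hminK]
    show minpoly ℚ c = minpoly ℚ b
    rw [hmin hc, hmin hb]
  have hne : (⟨a, memK ha⟩ : algebraicClosure ℚ ℂ) ≠ ⟨c, memK hc⟩ := fun h =>
    hac (congrArg Subtype.val h)
  have key := soloCC_conj_ne_ratConvexComb
    ((algebraicClosure ℚ ℂ).val : algebraicClosure ℚ ℂ →+* ℂ) h₁ h₂ hne hw0 hw1
  simpa using key

open Polynomial in
/-- **Corollary (no three roots on a rationally spaced affine progression).**  An irreducible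
`p ∈ ℚ[X]` has no three roots `γ + s₁ μ, γ + s₂ μ, γ + s₃ μ ∈ ℂ` with `μ ≠ 0` and rational
`s₁ < s₂ < s₃`; in particular no three distinct roots in arithmetic progression. -/
theorem soloCC_no_three_roots_in_rational_progression (p : ℚ[X]) (hp : Irreducible p)
    {γ μ : ℂ} (hμ : μ ≠ 0) {s₁ s₂ s₃ : ℚ} (h12 : s₁ < s₂) (h23 : s₂ < s₃)
    (h1 : aeval (γ + (s₁ : ℂ) * μ) p = 0) (h2 : aeval (γ + (s₂ : ℂ) * μ) p = 0)
    (h3 : aeval (γ + (s₃ : ℂ) * μ) p = 0) : False := by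
  have h13 : s₁ < s₃ := h12.trans h23
  have hw0 : 0 < (s₂ - s₁) / (s₃ - s₁) := div_pos (sub_pos.mpr h12) (sub_pos.mpr h13)
  have hw1 : (s₂ - s₁) / (s₃ - s₁) < 1 :=
    (div_lt_one (sub_pos.mpr h13)).mpr (sub_lt_sub_right h23 s₁)
  have hac : γ + (s₁ : ℂ) * μ ≠ γ + (s₃ : ℂ) * μ := by
    intro h
    have h' : ((s₁ : ℚ) : ℂ) = ((s₃ : ℚ) : ℂ) := mul_right_cancel₀ hμ (add_left_cancel h)
    exact (ne_of_lt h13) (by exact_mod_cast h')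
  refine soloCC_roots_ne_ratConvexComb p hp h1 h2 h3 hac hw0 hw1 ?_
  -- the affine identity `γ + s₂ μ = (1 - w) (γ + s₁ μ) + w (γ + s₃ μ)`, `w = (s₂ - s₁)/(s₃ - s₁)`
  have hdC : (s₃ : ℂ) - (s₁ : ℂ) ≠ 0 := sub_ne_zero.mpr (by exact_mod_cast ne_of_gt h13)
  push_cast
  field_simp
  ring

end Summit.Schanuel.Schanuel.Theorems
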